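import Summits.HodgeConjecture.HodgeConjecture.Theorems.Ring2WeilCoverageCMFieldRationalClassesFibres
import Summits.HodgeConjecture.HodgeConjecture.Theorems.Ring2WeilCoverageCMFieldRationalPrimeRule
import HarnessLib

/-!
# Ring 2 — Weil-family coverage, CM-field rows: RATIONAL classes are constant on the fibres of `Spec 𝓞_F → Spec ℤ`,
  instances III: the four quartic CM subfields of `ℚ(ζ₆₀)` outside the census (`ℚ(i,√15)`, `ℚ(√-5,√3)`, `ℚ(√-3,√-5)`, `ℚ(√-3(5+√5)/2)`) (WEIL-FAMILY-COVERAGE «## b03», cell (xxi′)(a), part 36)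

research route conditional on HC_CM; not a corollary; Q11.4-sentence-2 already refuted in dim ≥ 3.

For each quartic CM field `E` below, over its Deligne carrier `R = S² + pS + q` (`F = ℚ[S]/(R)`, `E = F(√θ)`; explicit `hR` in
every signature) [cite: Deligne1982HodgeCycles, §4 p. 30, (1), Cor. 4.2], part 33's table theorems are instantiated:
* `KEY_inl_mem_badPlaces_ratCast_iff` — **for every `c ∈ ℚ^×` and every odd prime `ℓ` (`ℓ ∤ b₀`, resp. `ℓ ∤ q`), `T(c)`
  contains BOTH places of `F` over `ℓ` or NONE** (biquadratic `E = F(√b₀)`: `θ = c₁²·b₀` written out and checked by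
  `linear_combination`; cyclic `E`: `q = s₀²` with `s₀ ∈ ℤ[θ]` written out);
* `KEY_badPlaces_ratCast_ne_pair` — **row form: `T(c) ≠ {v, w}` whenever `v ≠ v'` lie over such an `ℓ` and `w ≠ v'`**: a
  `|T| = 2` row of the table `W_{2k}.E.T` through ONE place of a split prime has no rational member — the «–» entries of
  §b03.5 / §b03.29 (2), for every rational number and every such row at once;
* where `F` has an odd ramified prime `ℓ₀ ∤ b₀`: `KEY_inl_notMem_badPlaces_ratCast_of_mem_…` — **the place over `ℓ₀` lies
  in NO `T(c)`** (`π = 2θ + p`, `π² = disc R = ℓ₀·w`, `(ℓ₀, w) = 1`, `e = 2`), with its row form `T(c) ≠ {v, w}` for all `w`.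
* §100 `ℚ(i,√15)` (`R = S² + 32S + 196`; `b₀ = -1`; ramified prime(s) 3, 5).
* §101 `ℚ(√-5,√3)` (`R = S² + 40S + 100`; `b₀ = -5`; ramified prime(s) 3).
* §102 `ℚ(√-3,√-5)` (`R = S² + 16S + 4`; `b₀ = -3`; ramified prime(s) 5; second class `b₀ = -5` for the ramified prime 3).
* §103 `ℚ(√-3(5+√5)/2)` (`R = S² + 15S + 45`; cyclic, `q = 45`).

No new definition, no named fact, no sorry; nothing about the Hodge conjecture is asserted.
-/

noncomputable section

set_option linter.dupNamespace false

open Polynomial NumberField IsDedekindDomain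

namespace Summit.HodgeConjecture.HodgeConjecture.Ring2.WeilCoverageCM

open Literature.AlgebraicGeometry.Deligne1982
open Literature.AlgebraicGeometry.HodgeTheory (splitDiscriminantClassCM)
open Literature.NumberTheory.QuadraticForms

variable {R : Polynomial ℤ} [Fact (Irreducible (cmPolyQ R))] [Fact (Irreducible (realPolyQ R))]

/-! ### §100 `E = ℚ(i,√15)` (`R = S² + 32S + 196`, `F = ℚ(√15)`, `E = F(√-1)`) -/
section IsqrtNeg1Sqrt15

omit [Fact (Irreducible (cmPolyQ R))] in
/-- `ℚ(i,√15)` (`R = S² + 32S + 196`): **`θ = c₁²·(-1)`** with `c₁ = -7 + (-1/2)·θ` — `E = F(√-1)`, `F = ℚ(√15)`.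
[cite: Deligne1982HodgeCycles, §4 p. 30] -/
theorem sqrtNeg1Sqrt15_root_eq_sq_mul_neg_one (hR : R = X ^ 2 + C 32 * X + C 196) :
    AdjoinRoot.root (realPolyQ R) = ((-7 : realField R) + (-1/2 : realField R) * AdjoinRoot.root (realPolyQ R)) ^ 2
      * (((-(1 : ℕ) : ℤ) : 𝓞 (realField R)) : realField R) := by
  have hrel := root_rel_quadratic hR
  push_cast at hrel
  rw [show (((-(1 : ℕ) : ℤ) : 𝓞 (realField R)) : realField R) = ((-(1 : ℕ) : ℤ) : realField R) from
    map_intCast (algebraMap (𝓞 (realField R)) (realField R)) _]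
  push_cast
  linear_combination (1/4 : realField R) * hrel

/-- **`ℚ(i,√15)`: for EVERY `c ∈ ℚ^×` and every odd prime `ℓ`, `T(c)` contains BOTH places of `F = ℚ(√15)` over `ℓ`
or NONE** — the rational classes of the table `W_{2k}.E.T` are constant on the fibres of `Spec 𝓞_F → Spec ℤ`.
[cite: Deligne1982HodgeCycles, §4 (1)] [cite: Omeara1963, §63B Cor. 63:11a and Example 63:12] -/
theorem sqrtNeg1Sqrt15_inl_mem_badPlaces_ratCast_iff (hR : R = X ^ 2 + C 32 * X + C 196) {ℓ : ℕ} (hℓ : ℓ.Prime)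
    (hℓ2 : ℓ ≠ 2) (v v' : HeightOneSpectrum (𝓞 (realField R)))
    (hv : (ℓ : 𝓞 (realField R)) ∈ v.asIdeal) (hv' : (ℓ : 𝓞 (realField R)) ∈ v'.asIdeal) {c : ℚ} (hc : c ≠ 0) :
    Sum.inl v ∈ badPlaces (c : realField R) (AdjoinRoot.root (realPolyQ R)) ↔
      Sum.inl v' ∈ badPlaces (c : realField R) (AdjoinRoot.root (realPolyQ R)) :=
  inl_mem_badPlaces_ratCast_iff_of_intCast_radicand hR (sqrtNeg1Sqrt15_root_eq_sq_mul_neg_one hR) hℓ hℓ2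
    (not_natCast_dvd_neg_natCast hℓ (Or.inl rfl) hℓ.one_lt.ne') v v' hv hv' hc

/-- **`ℚ(i,√15)`, row form: a `|T| = 2` row `{v, w}` with `v ≠ v'` the two places over an odd prime `ℓ` and
`w ≠ v'` has NO RATIONAL MEMBER**: `T(c) ≠ {v, w}` for every `c ∈ ℚ^×` (the «least rational n: –» rows, for every `n`).
[cite: Deligne1982HodgeCycles, §4 (1) and Cor. 4.2] -/
theorem sqrtNeg1Sqrt15_badPlaces_ratCast_ne_pair (hR : R = X ^ 2 + C 32 * X + C 196) {ℓ : ℕ} (hℓ : ℓ.Prime)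
    (hℓ2 : ℓ ≠ 2) (v v' w : HeightOneSpectrum (𝓞 (realField R)))
    (hv : (ℓ : 𝓞 (realField R)) ∈ v.asIdeal) (hv' : (ℓ : 𝓞 (realField R)) ∈ v'.asIdeal) (hne : v ≠ v') (hw : w ≠ v')
    {c : ℚ} (hc : c ≠ 0) :
    badPlaces (c : realField R) (AdjoinRoot.root (realPolyQ R)) ≠ {Sum.inl v, Sum.inl w} :=
  badPlaces_ratCast_ne_pair_of_intCast_radicand hR (sqrtNeg1Sqrt15_root_eq_sq_mul_neg_one hR) hℓ hℓ2
    (not_natCast_dvd_neg_natCast hℓ (Or.inl rfl) hℓ.one_lt.ne') v v' w hv hv' hne hw hc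

/-- **`ℚ(i,√15)`: the place of `F = ℚ(√15)` over the RAMIFIED prime `3` (inert in `E`) lies in NO `T(c)`, `c ∈ ℚ^×`**
(`π = 2θ + 32`, `π² = 240 = 3·80`, `(27)·3 + (-1)·80 = 1`: `(3, π)² = (3)`, `e = 2`, `ord_v c` even).
[cite: Omeara1963, §63B Cor. 63:11a and Example 63:12] [cite: Deligne1982HodgeCycles, §4 (1)] -/
theorem sqrtNeg1Sqrt15_inl_notMem_badPlaces_ratCast_of_mem_three (hR : R = X ^ 2 + C 32 * X + C 196)
    (v : HeightOneSpectrum (𝓞 (realField R))) (hv : (3 : 𝓞 (realField R)) ∈ v.asIdeal) {c : ℚ} (hc : c ≠ 0) :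
    Sum.inl v ∉ badPlaces (c : realField R) (AdjoinRoot.root (realPolyQ R)) := by
  obtain ⟨hRm, -⟩ := monic_and_natDegree_of_quadratic R hR
  obtain ⟨θₒ, hθ⟩ := exists_ringOfIntegers_coe_eq_root hRm
  have hrel := ringOfIntegers_root_rel_quadratic hR hθ
  push_cast at hrel
  have hπ : (2 * θₒ + 32) ^ 2 = ((3 : ℕ) : 𝓞 (realField R)) * 80 := by
    push_cast
    linear_combination (4 : 𝓞 (realField R)) * hrel
  have hv' : ((3 : ℕ) : 𝓞 (realField R)) ∈ v.asIdeal := by exact_mod_cast hv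
  have hb : (((-(1 : ℕ) : ℤ)) : 𝓞 (realField R)) ∉ v.asIdeal :=
    (intCast_mem_iff_natCast_dvd Nat.prime_three v hv' _).not.2
      (not_natCast_dvd_neg_natCast Nat.prime_three (Or.inl rfl) (by norm_num))
  exact inl_notMem_badPlaces_ratCast_of_sq_eq_mul hR (sqrtNeg1Sqrt15_root_eq_sq_mul_neg_one hR) Nat.prime_three (by norm_num) hπ
    (a := 27) (b := -1) (by push_cast; ring) v hv' hb hc

/-- **`ℚ(i,√15)`, row form at the ramified prime `3`**: `T(c) ≠ {v, w}` for the place `v ∋ 3`, every place `w` and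
every `c ∈ ℚ^×`. [cite: Deligne1982HodgeCycles, §4 (1) and Cor. 4.2] -/
theorem sqrtNeg1Sqrt15_badPlaces_ratCast_ne_pair_of_mem_three (hR : R = X ^ 2 + C 32 * X + C 196)
    (v w : HeightOneSpectrum (𝓞 (realField R))) (hv : (3 : 𝓞 (realField R)) ∈ v.asIdeal) {c : ℚ} (hc : c ≠ 0) :
    badPlaces (c : realField R) (AdjoinRoot.root (realPolyQ R)) ≠ {Sum.inl v, Sum.inl w} := by
  intro h
  have h1 : Sum.inl v ∈ badPlaces (c : realField R) (AdjoinRoot.root (realPolyQ R)) := by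
    rw [h]; exact Set.mem_insert _ _
  exact sqrtNeg1Sqrt15_inl_notMem_badPlaces_ratCast_of_mem_three hR v hv hc h1

/-- **`ℚ(i,√15)`: the place of `F = ℚ(√15)` over the RAMIFIED prime `5` (inert in `E`) lies in NO `T(c)`, `c ∈ ℚ^×`**
(`π = 2θ + 32`, `π² = 240 = 5·48`, `(-19)·5 + (2)·48 = 1`: `(5, π)² = (5)`, `e = 2`, `ord_v c` even).
[cite: Omeara1963, §63B Cor. 63:11a and Example 63:12] [cite: Deligne1982HodgeCycles, §4 (1)] -/
theorem sqrtNeg1Sqrt15_inl_notMem_badPlaces_ratCast_of_mem_five (hR : R = X ^ 2 + C 32 * X + C 196)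
    (v : HeightOneSpectrum (𝓞 (realField R))) (hv : (5 : 𝓞 (realField R)) ∈ v.asIdeal) {c : ℚ} (hc : c ≠ 0) :
    Sum.inl v ∉ badPlaces (c : realField R) (AdjoinRoot.root (realPolyQ R)) := by
  obtain ⟨hRm, -⟩ := monic_and_natDegree_of_quadratic R hR
  obtain ⟨θₒ, hθ⟩ := exists_ringOfIntegers_coe_eq_root hRm
  have hrel := ringOfIntegers_root_rel_quadratic hR hθ
  push_cast at hrel
  have hπ : (2 * θₒ + 32) ^ 2 = ((5 : ℕ) : 𝓞 (realField R)) * 48 := by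
    push_cast
    linear_combination (4 : 𝓞 (realField R)) * hrel
  have hv' : ((5 : ℕ) : 𝓞 (realField R)) ∈ v.asIdeal := by exact_mod_cast hv
  have hb : (((-(1 : ℕ) : ℤ)) : 𝓞 (realField R)) ∉ v.asIdeal :=
    (intCast_mem_iff_natCast_dvd Nat.prime_five v hv' _).not.2
      (not_natCast_dvd_neg_natCast Nat.prime_five (Or.inl rfl) (by norm_num))
  exact inl_notMem_badPlaces_ratCast_of_sq_eq_mul hR (sqrtNeg1Sqrt15_root_eq_sq_mul_neg_one hR) Nat.prime_five (by norm_num) hπ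
    (a := -19) (b := 2) (by push_cast; ring) v hv' hb hc

/-- **`ℚ(i,√15)`, row form at the ramified prime `5`**: `T(c) ≠ {v, w}` for the place `v ∋ 5`, every place `w` and
every `c ∈ ℚ^×`. [cite: Deligne1982HodgeCycles, §4 (1) and Cor. 4.2] -/
theorem sqrtNeg1Sqrt15_badPlaces_ratCast_ne_pair_of_mem_five (hR : R = X ^ 2 + C 32 * X + C 196)
    (v w : HeightOneSpectrum (𝓞 (realField R))) (hv : (5 : 𝓞 (realField R)) ∈ v.asIdeal) {c : ℚ} (hc : c ≠ 0) :
    badPlaces (c : realField R) (AdjoinRoot.root (realPolyQ R)) ≠ {Sum.inl v, Sum.inl w} := by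
  intro h
  have h1 : Sum.inl v ∈ badPlaces (c : realField R) (AdjoinRoot.root (realPolyQ R)) := by
    rw [h]; exact Set.mem_insert _ _
  exact sqrtNeg1Sqrt15_inl_notMem_badPlaces_ratCast_of_mem_five hR v hv hc h1

end IsqrtNeg1Sqrt15

/-! ### §101 `E = ℚ(√-5,√3)` (`R = S² + 40S + 100`, `F = ℚ(√3)`, `E = F(√-5)`) -/
section IsqrtNeg5Sqrt3

omit [Fact (Irreducible (cmPolyQ R))] in
/-- `ℚ(√-5,√3)` (`R = S² + 40S + 100`): **`θ = c₁²·(-5)`** with `c₁ = -1 + (-1/10)·θ` — `E = F(√-5)`, `F = ℚ(√3)`.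
[cite: Deligne1982HodgeCycles, §4 p. 30] -/
theorem sqrtNeg5Sqrt3_root_eq_sq_mul_neg_five (hR : R = X ^ 2 + C 40 * X + C 100) :
    AdjoinRoot.root (realPolyQ R) = ((-1 : realField R) + (-1/10 : realField R) * AdjoinRoot.root (realPolyQ R)) ^ 2
      * (((-(5 : ℕ) : ℤ) : 𝓞 (realField R)) : realField R) := by
  have hrel := root_rel_quadratic hR
  push_cast at hrel
  rw [show (((-(5 : ℕ) : ℤ) : 𝓞 (realField R)) : realField R) = ((-(5 : ℕ) : ℤ) : realField R) from
    map_intCast (algebraMap (𝓞 (realField R)) (realField R)) _]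
  push_cast
  linear_combination (1/20 : realField R) * hrel

/-- **`ℚ(√-5,√3)`: for EVERY `c ∈ ℚ^×` and every odd prime `ℓ`, `ℓ ≠ 5`, `T(c)` contains BOTH places of `F = ℚ(√3)` over `ℓ`
or NONE** — the rational classes of the table `W_{2k}.E.T` are constant on the fibres of `Spec 𝓞_F → Spec ℤ`.
[cite: Deligne1982HodgeCycles, §4 (1)] [cite: Omeara1963, §63B Cor. 63:11a and Example 63:12] -/
theorem sqrtNeg5Sqrt3_inl_mem_badPlaces_ratCast_iff (hR : R = X ^ 2 + C 40 * X + C 100) {ℓ : ℕ} (hℓ : ℓ.Prime)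
    (hℓ2 : ℓ ≠ 2) (hℓ5 : ℓ ≠ 5) (v v' : HeightOneSpectrum (𝓞 (realField R)))
    (hv : (ℓ : 𝓞 (realField R)) ∈ v.asIdeal) (hv' : (ℓ : 𝓞 (realField R)) ∈ v'.asIdeal) {c : ℚ} (hc : c ≠ 0) :
    Sum.inl v ∈ badPlaces (c : realField R) (AdjoinRoot.root (realPolyQ R)) ↔
      Sum.inl v' ∈ badPlaces (c : realField R) (AdjoinRoot.root (realPolyQ R)) :=
  inl_mem_badPlaces_ratCast_iff_of_intCast_radicand hR (sqrtNeg5Sqrt3_root_eq_sq_mul_neg_five hR) hℓ hℓ2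
    (not_natCast_dvd_neg_natCast hℓ (Or.inr Nat.prime_five) hℓ5) v v' hv hv' hc

/-- **`ℚ(√-5,√3)`, row form: a `|T| = 2` row `{v, w}` with `v ≠ v'` the two places over an odd prime `ℓ`, `ℓ ≠ 5` and
`w ≠ v'` has NO RATIONAL MEMBER**: `T(c) ≠ {v, w}` for every `c ∈ ℚ^×` (the «least rational n: –» rows, for every `n`).
[cite: Deligne1982HodgeCycles, §4 (1) and Cor. 4.2] -/
theorem sqrtNeg5Sqrt3_badPlaces_ratCast_ne_pair (hR : R = X ^ 2 + C 40 * X + C 100) {ℓ : ℕ} (hℓ : ℓ.Prime)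
    (hℓ2 : ℓ ≠ 2) (hℓ5 : ℓ ≠ 5) (v v' w : HeightOneSpectrum (𝓞 (realField R)))
    (hv : (ℓ : 𝓞 (realField R)) ∈ v.asIdeal) (hv' : (ℓ : 𝓞 (realField R)) ∈ v'.asIdeal) (hne : v ≠ v') (hw : w ≠ v')
    {c : ℚ} (hc : c ≠ 0) :
    badPlaces (c : realField R) (AdjoinRoot.root (realPolyQ R)) ≠ {Sum.inl v, Sum.inl w} :=
  badPlaces_ratCast_ne_pair_of_intCast_radicand hR (sqrtNeg5Sqrt3_root_eq_sq_mul_neg_five hR) hℓ hℓ2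
    (not_natCast_dvd_neg_natCast hℓ (Or.inr Nat.prime_five) hℓ5) v v' w hv hv' hne hw hc

/-- **`ℚ(√-5,√3)`: the place of `F = ℚ(√3)` over the RAMIFIED prime `3` (inert in `E`) lies in NO `T(c)`, `c ∈ ℚ^×`**
(`π = 2θ + 40`, `π² = 1200 = 3·400`, `(-133)·3 + (1)·400 = 1`: `(3, π)² = (3)`, `e = 2`, `ord_v c` even).
[cite: Omeara1963, §63B Cor. 63:11a and Example 63:12] [cite: Deligne1982HodgeCycles, §4 (1)] -/
theorem sqrtNeg5Sqrt3_inl_notMem_badPlaces_ratCast_of_mem_three (hR : R = X ^ 2 + C 40 * X + C 100)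
    (v : HeightOneSpectrum (𝓞 (realField R))) (hv : (3 : 𝓞 (realField R)) ∈ v.asIdeal) {c : ℚ} (hc : c ≠ 0) :
    Sum.inl v ∉ badPlaces (c : realField R) (AdjoinRoot.root (realPolyQ R)) := by
  obtain ⟨hRm, -⟩ := monic_and_natDegree_of_quadratic R hR
  obtain ⟨θₒ, hθ⟩ := exists_ringOfIntegers_coe_eq_root hRm
  have hrel := ringOfIntegers_root_rel_quadratic hR hθ
  push_cast at hrel
  have hπ : (2 * θₒ + 40) ^ 2 = ((3 : ℕ) : 𝓞 (realField R)) * 400 := by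
    push_cast
    linear_combination (4 : 𝓞 (realField R)) * hrel
  have hv' : ((3 : ℕ) : 𝓞 (realField R)) ∈ v.asIdeal := by exact_mod_cast hv
  have hb : (((-(5 : ℕ) : ℤ)) : 𝓞 (realField R)) ∉ v.asIdeal :=
    (intCast_mem_iff_natCast_dvd Nat.prime_three v hv' _).not.2
      (not_natCast_dvd_neg_natCast Nat.prime_three (Or.inr Nat.prime_five) (by norm_num))
  exact inl_notMem_badPlaces_ratCast_of_sq_eq_mul hR (sqrtNeg5Sqrt3_root_eq_sq_mul_neg_five hR) Nat.prime_three (by norm_num) hπ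
    (a := -133) (b := 1) (by push_cast; ring) v hv' hb hc

/-- **`ℚ(√-5,√3)`, row form at the ramified prime `3`**: `T(c) ≠ {v, w}` for the place `v ∋ 3`, every place `w` and
every `c ∈ ℚ^×`. [cite: Deligne1982HodgeCycles, §4 (1) and Cor. 4.2] -/
theorem sqrtNeg5Sqrt3_badPlaces_ratCast_ne_pair_of_mem_three (hR : R = X ^ 2 + C 40 * X + C 100)
    (v w : HeightOneSpectrum (𝓞 (realField R))) (hv : (3 : 𝓞 (realField R)) ∈ v.asIdeal) {c : ℚ} (hc : c ≠ 0) :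
    badPlaces (c : realField R) (AdjoinRoot.root (realPolyQ R)) ≠ {Sum.inl v, Sum.inl w} := by
  intro h
  have h1 : Sum.inl v ∈ badPlaces (c : realField R) (AdjoinRoot.root (realPolyQ R)) := by
    rw [h]; exact Set.mem_insert _ _
  exact sqrtNeg5Sqrt3_inl_notMem_badPlaces_ratCast_of_mem_three hR v hv hc h1

end IsqrtNeg5Sqrt3

/-! ### §102 `E = ℚ(√-3,√-5)` (`R = S² + 16S + 4`, `F = ℚ(√15)`, `E = F(√-3)`) -/
section IsqrtNeg3SqrtNeg5

omit [Fact (Irreducible (cmPolyQ R))] in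
/-- `ℚ(√-3,√-5)` (`R = S² + 16S + 4`): **`θ = c₁²·(-3)`** with `c₁ = -1/3 + (-1/6)·θ` — `E = F(√-3)`, `F = ℚ(√15)`.
[cite: Deligne1982HodgeCycles, §4 p. 30] -/
theorem sqrtNeg3SqrtNeg5_root_eq_sq_mul_neg_three (hR : R = X ^ 2 + C 16 * X + C 4) :
    AdjoinRoot.root (realPolyQ R) = ((-1/3 : realField R) + (-1/6 : realField R) * AdjoinRoot.root (realPolyQ R)) ^ 2
      * (((-(3 : ℕ) : ℤ) : 𝓞 (realField R)) : realField R) := by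
  have hrel := root_rel_quadratic hR
  push_cast at hrel
  rw [show (((-(3 : ℕ) : ℤ) : 𝓞 (realField R)) : realField R) = ((-(3 : ℕ) : ℤ) : realField R) from
    map_intCast (algebraMap (𝓞 (realField R)) (realField R)) _]
  push_cast
  linear_combination (1/12 : realField R) * hrel

/-- **`ℚ(√-3,√-5)`: for EVERY `c ∈ ℚ^×` and every odd prime `ℓ`, `ℓ ≠ 3`, `T(c)` contains BOTH places of `F = ℚ(√15)` over `ℓ`
or NONE** — the rational classes of the table `W_{2k}.E.T` are constant on the fibres of `Spec 𝓞_F → Spec ℤ`.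
[cite: Deligne1982HodgeCycles, §4 (1)] [cite: Omeara1963, §63B Cor. 63:11a and Example 63:12] -/
theorem sqrtNeg3SqrtNeg5_inl_mem_badPlaces_ratCast_iff (hR : R = X ^ 2 + C 16 * X + C 4) {ℓ : ℕ} (hℓ : ℓ.Prime)
    (hℓ2 : ℓ ≠ 2) (hℓ3 : ℓ ≠ 3) (v v' : HeightOneSpectrum (𝓞 (realField R)))
    (hv : (ℓ : 𝓞 (realField R)) ∈ v.asIdeal) (hv' : (ℓ : 𝓞 (realField R)) ∈ v'.asIdeal) {c : ℚ} (hc : c ≠ 0) :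
    Sum.inl v ∈ badPlaces (c : realField R) (AdjoinRoot.root (realPolyQ R)) ↔
      Sum.inl v' ∈ badPlaces (c : realField R) (AdjoinRoot.root (realPolyQ R)) :=
  inl_mem_badPlaces_ratCast_iff_of_intCast_radicand hR (sqrtNeg3SqrtNeg5_root_eq_sq_mul_neg_three hR) hℓ hℓ2
    (not_natCast_dvd_neg_natCast hℓ (Or.inr Nat.prime_three) hℓ3) v v' hv hv' hc

/-- **`ℚ(√-3,√-5)`, row form: a `|T| = 2` row `{v, w}` with `v ≠ v'` the two places over an odd prime `ℓ`, `ℓ ≠ 3` and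
`w ≠ v'` has NO RATIONAL MEMBER**: `T(c) ≠ {v, w}` for every `c ∈ ℚ^×` (the «least rational n: –» rows, for every `n`).
[cite: Deligne1982HodgeCycles, §4 (1) and Cor. 4.2] -/
theorem sqrtNeg3SqrtNeg5_badPlaces_ratCast_ne_pair (hR : R = X ^ 2 + C 16 * X + C 4) {ℓ : ℕ} (hℓ : ℓ.Prime)
    (hℓ2 : ℓ ≠ 2) (hℓ3 : ℓ ≠ 3) (v v' w : HeightOneSpectrum (𝓞 (realField R)))
    (hv : (ℓ : 𝓞 (realField R)) ∈ v.asIdeal) (hv' : (ℓ : 𝓞 (realField R)) ∈ v'.asIdeal) (hne : v ≠ v') (hw : w ≠ v')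
    {c : ℚ} (hc : c ≠ 0) :
    badPlaces (c : realField R) (AdjoinRoot.root (realPolyQ R)) ≠ {Sum.inl v, Sum.inl w} :=
  badPlaces_ratCast_ne_pair_of_intCast_radicand hR (sqrtNeg3SqrtNeg5_root_eq_sq_mul_neg_three hR) hℓ hℓ2
    (not_natCast_dvd_neg_natCast hℓ (Or.inr Nat.prime_three) hℓ3) v v' w hv hv' hne hw hc

/-- **`ℚ(√-3,√-5)`: the place of `F = ℚ(√15)` over the RAMIFIED prime `5` (inert in `E`) lies in NO `T(c)`, `c ∈ ℚ^×`**
(`π = 2θ + 16`, `π² = 240 = 5·48`, `(-19)·5 + (2)·48 = 1`: `(5, π)² = (5)`, `e = 2`, `ord_v c` even).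
[cite: Omeara1963, §63B Cor. 63:11a and Example 63:12] [cite: Deligne1982HodgeCycles, §4 (1)] -/
theorem sqrtNeg3SqrtNeg5_inl_notMem_badPlaces_ratCast_of_mem_five (hR : R = X ^ 2 + C 16 * X + C 4)
    (v : HeightOneSpectrum (𝓞 (realField R))) (hv : (5 : 𝓞 (realField R)) ∈ v.asIdeal) {c : ℚ} (hc : c ≠ 0) :
    Sum.inl v ∉ badPlaces (c : realField R) (AdjoinRoot.root (realPolyQ R)) := by
  obtain ⟨hRm, -⟩ := monic_and_natDegree_of_quadratic R hR
  obtain ⟨θₒ, hθ⟩ := exists_ringOfIntegers_coe_eq_root hRm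
  have hrel := ringOfIntegers_root_rel_quadratic hR hθ
  push_cast at hrel
  have hπ : (2 * θₒ + 16) ^ 2 = ((5 : ℕ) : 𝓞 (realField R)) * 48 := by
    push_cast
    linear_combination (4 : 𝓞 (realField R)) * hrel
  have hv' : ((5 : ℕ) : 𝓞 (realField R)) ∈ v.asIdeal := by exact_mod_cast hv
  have hb : (((-(3 : ℕ) : ℤ)) : 𝓞 (realField R)) ∉ v.asIdeal :=
    (intCast_mem_iff_natCast_dvd Nat.prime_five v hv' _).not.2
      (not_natCast_dvd_neg_natCast Nat.prime_five (Or.inr Nat.prime_three) (by norm_num))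
  exact inl_notMem_badPlaces_ratCast_of_sq_eq_mul hR (sqrtNeg3SqrtNeg5_root_eq_sq_mul_neg_three hR) Nat.prime_five (by norm_num) hπ
    (a := -19) (b := 2) (by push_cast; ring) v hv' hb hc

/-- **`ℚ(√-3,√-5)`, row form at the ramified prime `5`**: `T(c) ≠ {v, w}` for the place `v ∋ 5`, every place `w` and
every `c ∈ ℚ^×`. [cite: Deligne1982HodgeCycles, §4 (1) and Cor. 4.2] -/
theorem sqrtNeg3SqrtNeg5_badPlaces_ratCast_ne_pair_of_mem_five (hR : R = X ^ 2 + C 16 * X + C 4)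
    (v w : HeightOneSpectrum (𝓞 (realField R))) (hv : (5 : 𝓞 (realField R)) ∈ v.asIdeal) {c : ℚ} (hc : c ≠ 0) :
    badPlaces (c : realField R) (AdjoinRoot.root (realPolyQ R)) ≠ {Sum.inl v, Sum.inl w} := by
  intro h
  have h1 : Sum.inl v ∈ badPlaces (c : realField R) (AdjoinRoot.root (realPolyQ R)) := by
    rw [h]; exact Set.mem_insert _ _
  exact sqrtNeg3SqrtNeg5_inl_notMem_badPlaces_ratCast_of_mem_five hR v hv hc h1

omit [Fact (Irreducible (cmPolyQ R))] in
/-- `ℚ(√-3,√-5)` (`R = S² + 16S + 4`): **`θ = c₁²·(-5)`** with `c₁ = -1/5 + (1/10)·θ` — `E = F(√-5)`, `F = ℚ(√15)`.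
[cite: Deligne1982HodgeCycles, §4 p. 30] -/
theorem sqrtNeg3SqrtNeg5_root_eq_sq_mul_neg_five (hR : R = X ^ 2 + C 16 * X + C 4) :
    AdjoinRoot.root (realPolyQ R) = ((-1/5 : realField R) + (1/10 : realField R) * AdjoinRoot.root (realPolyQ R)) ^ 2
      * (((-(5 : ℕ) : ℤ) : 𝓞 (realField R)) : realField R) := by
  have hrel := root_rel_quadratic hR
  push_cast at hrel
  rw [show (((-(5 : ℕ) : ℤ) : 𝓞 (realField R)) : realField R) = ((-(5 : ℕ) : ℤ) : realField R) from
    map_intCast (algebraMap (𝓞 (realField R)) (realField R)) _]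
  push_cast
  linear_combination (1/20 : realField R) * hrel

/-- **`ℚ(√-3,√-5)`: the place of `F = ℚ(√15)` over the RAMIFIED prime `3` (inert in `E`) lies in NO `T(c)`, `c ∈ ℚ^×`**
(`π = 2θ + 16`, `π² = 240 = 3·80`, `(27)·3 + (-1)·80 = 1`: `(3, π)² = (3)`, `e = 2`, `ord_v c` even).
[cite: Omeara1963, §63B Cor. 63:11a and Example 63:12] [cite: Deligne1982HodgeCycles, §4 (1)] -/
theorem sqrtNeg3SqrtNeg5_inl_notMem_badPlaces_ratCast_of_mem_three (hR : R = X ^ 2 + C 16 * X + C 4)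
    (v : HeightOneSpectrum (𝓞 (realField R))) (hv : (3 : 𝓞 (realField R)) ∈ v.asIdeal) {c : ℚ} (hc : c ≠ 0) :
    Sum.inl v ∉ badPlaces (c : realField R) (AdjoinRoot.root (realPolyQ R)) := by
  obtain ⟨hRm, -⟩ := monic_and_natDegree_of_quadratic R hR
  obtain ⟨θₒ, hθ⟩ := exists_ringOfIntegers_coe_eq_root hRm
  have hrel := ringOfIntegers_root_rel_quadratic hR hθ
  push_cast at hrel
  have hπ : (2 * θₒ + 16) ^ 2 = ((3 : ℕ) : 𝓞 (realField R)) * 80 := by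
    push_cast
    linear_combination (4 : 𝓞 (realField R)) * hrel
  have hv' : ((3 : ℕ) : 𝓞 (realField R)) ∈ v.asIdeal := by exact_mod_cast hv
  have hb : (((-(5 : ℕ) : ℤ)) : 𝓞 (realField R)) ∉ v.asIdeal :=
    (intCast_mem_iff_natCast_dvd Nat.prime_three v hv' _).not.2
      (not_natCast_dvd_neg_natCast Nat.prime_three (Or.inr Nat.prime_five) (by norm_num))
  exact inl_notMem_badPlaces_ratCast_of_sq_eq_mul hR (sqrtNeg3SqrtNeg5_root_eq_sq_mul_neg_five hR) Nat.prime_three (by norm_num) hπ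
    (a := 27) (b := -1) (by push_cast; ring) v hv' hb hc

/-- **`ℚ(√-3,√-5)`, row form at the ramified prime `3`**: `T(c) ≠ {v, w}` for the place `v ∋ 3`, every place `w` and
every `c ∈ ℚ^×`. [cite: Deligne1982HodgeCycles, §4 (1) and Cor. 4.2] -/
theorem sqrtNeg3SqrtNeg5_badPlaces_ratCast_ne_pair_of_mem_three (hR : R = X ^ 2 + C 16 * X + C 4)
    (v w : HeightOneSpectrum (𝓞 (realField R))) (hv : (3 : 𝓞 (realField R)) ∈ v.asIdeal) {c : ℚ} (hc : c ≠ 0) :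
    badPlaces (c : realField R) (AdjoinRoot.root (realPolyQ R)) ≠ {Sum.inl v, Sum.inl w} := by
  intro h
  have h1 : Sum.inl v ∈ badPlaces (c : realField R) (AdjoinRoot.root (realPolyQ R)) := by
    rw [h]; exact Set.mem_insert _ _
  exact sqrtNeg3SqrtNeg5_inl_notMem_badPlaces_ratCast_of_mem_three hR v hv hc h1

end IsqrtNeg3SqrtNeg5

/-! ### §103 `E = ℚ(√-3(5+√5)/2)` (`R = S² + 15S + 45`, `F = ℚ(√5)`, `E/ℚ` cyclic: `q = 45 = s₀²`, `s₀ = 15 + 2θ`) -/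
section IsqrtNegThreeTimesFivePlusSqrtFiveHalf

/-- **`ℚ(√-3(5+√5)/2)` (cyclic): for EVERY `c ∈ ℚ^×` and every odd prime `ℓ`, `ℓ ≠ 3`, `ℓ ≠ 5`, `T(c)` contains BOTH places of
`F = ℚ(√5)` over `ℓ` or NONE** (`q = 45 = (15 + 2θ)²` in `ℤ[θ]`: the residues of `θ` at the two places over a split `ℓ` are
the two roots of `R̄`, of square product). [cite: Deligne1982HodgeCycles, §4 (1)] [cite: Omeara1963, §63B Cor. 63:11a] -/
theorem sqrtNegThreeTimesFivePlusSqrtFiveHalf_inl_mem_badPlaces_ratCast_iff (hR : R = X ^ 2 + C 15 * X + C 45) {ℓ : ℕ} (hℓ : ℓ.Prime)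
    (hℓ2 : ℓ ≠ 2) (hℓ3 : ℓ ≠ 3) (hℓ5 : ℓ ≠ 5) (v v' : HeightOneSpectrum (𝓞 (realField R)))
    (hv : (ℓ : 𝓞 (realField R)) ∈ v.asIdeal) (hv' : (ℓ : 𝓞 (realField R)) ∈ v'.asIdeal) {c : ℚ} (hc : c ≠ 0) :
    Sum.inl v ∈ badPlaces (c : realField R) (AdjoinRoot.root (realPolyQ R)) ↔
      Sum.inl v' ∈ badPlaces (c : realField R) (AdjoinRoot.root (realPolyQ R)) := by
  obtain ⟨hRm, -⟩ := monic_and_natDegree_of_quadratic R hR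
  obtain ⟨θₒ, hθ⟩ := exists_ringOfIntegers_coe_eq_root hRm
  have hrel := ringOfIntegers_root_rel_quadratic hR hθ
  push_cast at hrel
  have hs : ((15 : 𝓞 (realField R)) + 2 * θₒ) ^ 2 = ((45 : ℤ) : 𝓞 (realField R)) := by
    push_cast
    linear_combination (4 : 𝓞 (realField R)) * hrel
  have hℓq : ¬ (ℓ : ℤ) ∣ 45 := fun h ↦ by
    have h' : ℓ ∣ 2 ^ 0 * 3 ^ 2 * 5 ^ 1 := by norm_num; exact_mod_cast h
    rcases eq_of_prime_dvd_two_pow_mul hℓ h' with rfl | rfl | rfl <;> omega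
  exact inl_mem_badPlaces_ratCast_iff_of_sq_eq hR hθ hs hℓ hℓ2 hℓq v v' hv hv' hc

/-- **`ℚ(√-3(5+√5)/2)`, row form: a `|T| = 2` row `{v, w}` with `v ≠ v'` the two places over an odd prime `ℓ`, `ℓ ≠ 3`, `ℓ ≠ 5`
and `w ≠ v'` has NO RATIONAL MEMBER**: `T(c) ≠ {v, w}` for every `c ∈ ℚ^×`.
[cite: Deligne1982HodgeCycles, §4 (1) and Cor. 4.2] -/
theorem sqrtNegThreeTimesFivePlusSqrtFiveHalf_badPlaces_ratCast_ne_pair (hR : R = X ^ 2 + C 15 * X + C 45) {ℓ : ℕ} (hℓ : ℓ.Prime)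
    (hℓ2 : ℓ ≠ 2) (hℓ3 : ℓ ≠ 3) (hℓ5 : ℓ ≠ 5) (v v' w : HeightOneSpectrum (𝓞 (realField R)))
    (hv : (ℓ : 𝓞 (realField R)) ∈ v.asIdeal) (hv' : (ℓ : 𝓞 (realField R)) ∈ v'.asIdeal) (hne : v ≠ v') (hw : w ≠ v')
    {c : ℚ} (hc : c ≠ 0) :
    badPlaces (c : realField R) (AdjoinRoot.root (realPolyQ R)) ≠ {Sum.inl v, Sum.inl w} := by
  intro h
  have h1 : Sum.inl v ∈ badPlaces (c : realField R) (AdjoinRoot.root (realPolyQ R)) := by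
    rw [h]; exact Set.mem_insert _ _
  have h2 := (sqrtNegThreeTimesFivePlusSqrtFiveHalf_inl_mem_badPlaces_ratCast_iff hR hℓ hℓ2 hℓ3 hℓ5 v v' hv hv' hc).1 h1
  rw [h, Set.mem_insert_iff, Set.mem_singleton_iff] at h2
  rcases h2 with h2 | h2
  · exact hne (Sum.inl_injective h2).symm
  · exact hw (Sum.inl_injective h2).symm

end IsqrtNegThreeTimesFivePlusSqrtFiveHalf

end Summit.HodgeConjecture.HodgeConjecture.Ring2.WeilCoverageCM

end
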